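import Summits.CriticalPhenomena.Ising3D.Control2DL19OpeLCTable
import Mathlib.Tactic.NormNum
import HarnessLib

/-!
# RB-6 ope2 (sense lower) certificate `j137649_functional_deriv2d_L19_E048_sig1o8_ope2lower_P31o2000.json` (Λ = 19, E₀ = 48): p_T > 31/2000 at Δ_σ = 1/8 under A2D′ with the ε box [49/50, 20001/20000] (⇒ c < (1/8)²/(2·31/2000) = 0.5040323 by the Ward identity) — (R), the large-`S` half, in the kernel
(cell `pub-ising3x`, seat controls-1 gen 21; KERNEL PATH for the 2D γ-certificates, Λ = 19 — CONTROL-ONLY)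

HONEST FRAMING: lottery ticket; floor = tightest certified 3D Ising CFT bounds; no exact-solution
claim without a proof. CONTROL-ONLY (`d = 2`, `Δ_σ = 1/8`, the 2D Ising control; axiom set `A2D′`).

(R) for the table `wtopeLC` (`Control2DL19OpeLCTable`), kernel data only: the compactified region polynomial `QhatopeLC`
(`S₁ = 72`, `d = 19`) is non-negative on `τ ∈ [0,1]`, `v ∈ [0,1]` by the tensor-Bernstein SHAPE tree `cregopeLC`
(6 leaves; every Bernstein coefficient computed and decided in the kernel, `Control2DPolyCertAuto2`, in 1 chunks of
≤ 12 leaves re-assembled along the splits), and `S ≤ S₁` by the per-`J` shapes `cregJopeLC` of the Table file;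
the root fact `cregopeLC_n0` and the per-`J` fact `cregJopeLC_ok` are turned into hypothesis `hR` by `region_of_kernelCertAuto` INSIDE the assembly file `Control2DL19OpeLC` (no standalone `region_opeLC` theorem: its statement would coincide, up to the table's name, with the other Λ = 19 boxes' — gate dedup lint, controls-1 g17). No facts, standard axioms only.
-/

namespace Summit.CriticalPhenomena.Ising3D.Control2D

open Literature.MathematicalPhysics.QuantumFieldTheory.ConformalBootstrap3D

set_option maxHeartbeats 0 in
set_option maxRecDepth 200000 in
/-- Chunk 0 of the large-`S` tree (box `q₁=1, a₁=0; q₂=1, a₂=0`; 6 leaves), decided in the kernel. [folklore] -/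
theorem cregopeLC_n0 :
    checkAuto₂ QhatopeLC 20 1 0 1 1 0 1
    (Shape₂.splitO (Shape₂.splitI (Shape₂.leaf) (Shape₂.leaf)) (Shape₂.splitI (Shape₂.splitO (Shape₂.leaf) (Shape₂.splitI (Shape₂.leaf) (Shape₂.leaf))) (Shape₂.leaf))) = true := by
  decide +kernel

end Summit.CriticalPhenomena.Ising3D.Control2D
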